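import Summits.HodgeConjecture.HodgeConjecture.Theorems.F0P6aLineSpecialisation
import Literature.AlgebraicGeometry.AbelianSchemes.SerreTranslateCoverLeg
import Literature.AlgebraicGeometry.AbelianSchemes.RoofLegsSpecialFibre
import Summits.HodgeConjecture.HodgeConjecture.Theorems.F0P6aRoofCwKernel
import Summits.HodgeConjecture.HodgeConjecture.Theorems.F0P6aRoofFrobKernelLawAssembly
import Literature.RingTheory.DedekindDomain.CRTIdempotentFamily
import Summits.HodgeConjecture.HodgeConjecture.Theorems.F0P6aStubFROBRoofMiddleDualTop
import HarnessLib
import HarnessLib.Audit.LibrarySuggestionsDenyListCruxes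

/-!
# `F0P6aStubFROBRoofGeoHoles` — ★ RE-HOME of the crux workfile `Lines/F0_P6a_StubFROBRoofGeo.lean` (tree sha16 fb6a2bad2c513567, 576 l., 20 declaration commands, code-`sorry`-free), PART 1 of 2

This `Theorems/` module is the TREE BYTES of that workfile with the NAMESPACE KEPT, so every fully-qualified name is UNCHANGED; only this module docstring is re-headed,
the `Lines` imports are switched to their ★ re-homed twins — `Lines.F0_P6a_LineSpecialisation` → ★ `Theorems.F0P6aLineSpecialisation`; `Lines.F0_P6a_RoofCwKernel` → ★ `Theorems.F0P6aRoofCwKernel`; `Lines.F0_P6a_RoofFrobKernelLawAssembly` → ★ `Theorems.F0P6aRoofFrobKernelLawAssembly` — and the audit carrier `LibrarySuggestionsDenyListCruxes` is CARRIED on this root part (bare import, LEAD «M-142d» (1) rule «P-κ»; parts 2…n inherit it transitively)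
Why a re-home: a `Theorems/` file cannot import a `Lines/` workfile (F0P6-ref1 o-6), and closing stmt-HodgeConjecture-24832 `--as proved --by <Theorems decl>` at rung 0 needs the
sorry-free `Lines` chain behind the gate (RE-HOME TABLE v1.7, LA7-plan (g7); PLAN «L3 cone RE-HOME» v1, LA3-plan (g5); LEAD F0P6-plan (g5) «M-140» (1)∕(4), 2026-09-02).
SIZE LINT (`Theorems/` files with proofs ≤ 400 l.): the workfile is cut into 2 consecutive parts `F0P6aStubFROBRoofGeoHoles` → `F0P6aStubFROBRoofGeo`; this is PART 1 (tree lines :1–:361); each later part imports the previous one and re-opens the scopes open at its cut with their `variable`∕`open`∕`set_option` lines replayed verbatim; the LAST part `F0P6aStubFROBRoofGeo` is the module the `Lines/` shim and consumers import.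
After the chain is ★ the `Lines` workfile becomes a one-import SHIM of `F0P6aStubFROBRoofGeo` (a `Lines/` write, batched per cone on the LEAD՚s word), so no environment holds two copies (NO-CROSS-IMPORT).
It asserts nothing beyond what the workfile already proves.  HC_CM is proved only modulo the 7 printed citations (2 remaining: hLiu418 = stmt-HodgeConjecture-24832, h413 = stmt-HodgeConjecture-24833) until rung 0 closes; a re-home is count-neutral.

## Original module docstring (verbatim)
# F0 · P6a — LEAFLET `Lines/F0_P6a_StubFROBRoofGeo.lean` cand: W5 «THE `stub_ROOFGEO` JUNCTION» — SKELETON v4 (LA3-p02 (g3); LA3-plan (g2) deal 2026-09-02T07:25:01Z (2))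

`crux_decl: Summit.HodgeConjecture.HodgeConjecture.Theses.HCCMUnconditional.HLiu418`.  Cell `hodgecm-mathlib`, line L3 (socket `stub_FROB` ▸ `stub_ROOF0` ▸
`stub_ROOFGEO`, leaf ED. 3 cand v2 4f35c0d6 :357–:396); item stmt-HodgeConjecture-24832, count-neutral, nothing registered, no crux write (HOME-first).
HC_CM is proved only modulo the printed citations (2 remaining named inputs hLiu418 24832, h413 24833) until rung 0 closes.

ONE theorem `roofgeo_of_inputs` whose CONCLUSION is `stub_ROOFGEO`'s (`Quot₀RoofLaw I 𝔡 quotΩ (spGeoOf I 𝔡) frobIdeal`, the leaf instantiating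
`frobIdeal := frobIdealOf 𝔞 w` — LA3-plan (g2) 08:16:23Z (2): the leaflet never imports the leaf; `_hpin` reads `FrobPin₀`'s BODY) over `stub_ROOFGEO`'s binders VERBATIM
+ `(frobIdeal) (hfrob)`, PLUS — until the suppliers land — the LEGS' reduced hom as an explicit function `qbarOf y L` and ONE NAMED HOLE per junction row
(`hole_*`, each annotated with its supplier and currency); the body is the junction itself: `Roof₀` packaged by `roof₀_of_rows` (W1 §5, copied) from the legs'
rows, the ★ cover-leg rows (r2₀)(r4₀-c)(r5₀-c) (★ p847713, ★ `RoofLegsSpecialFibre`), the middle dual (W1 §2 hole), and the (rL) law from the RE-POINTED W3 head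
(`hole_rL`, binders `𝔞γ hban h𝔠 hq` instead of `I.twistIdeal`) fed by the `w`-block law (`hole_hlaw_w`, W-DOCK `rL_W'` at `x̄`) and the `c•w`-block law
`hlaw_cw_of_dockClauses` (W2 §2, copied) over `hole_dock`, `hole_hF`, ★ `hsat_sch₀Of` (W2 §4 = ★ p850080 glue, copied) and `hunr`.  Each landing deletes one binder;
W5 = the day the hole list is empty.  0 `sorry`.  COPIED SECTIONS are marked «COPY of <file> <sha16> <§>» and are byte-identical to their HOME sources.
[cite: Liu2021, Prop. D.8 (3) p. 135, pp. 136–138] [cite: RapoportSmithlingZhang2020Diagonal, §4.3 (4.23) p. 21] [cite: Kottwitz1992, §5 (p. 391)]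
-/

set_option autoImplicit false
set_option linter.dupNamespace false
set_option linter.unusedSectionVars false

noncomputable section

namespace Summit.HodgeConjecture.HodgeConjecture.Cruxes.HLiu418.F0P6aStubFROBRoofGeo

open CategoryTheory CategoryTheory.Limits NumberField IsDedekindDomain MulAction AlgebraicGeometry
open scoped Matrix Pointwise MonoidalCategory MonObj CategoryTheory.Obj Polynomial
open Literature.NumberTheory.GaloisRepresentations
open Literature.NumberTheory.Automorphic Literature.NumberTheory.Automorphic.UnitaryGroup
open Literature.AlgebraicGeometry.ShimuraVarieties.UnitaryCanonicalModel
open Literature.NumberTheory.Automorphic.Liu2021.AppendixC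
open Literature.AlgebraicGeometry.Motives (AlgPoints IntegralModel SchemeOver thickening thickeningLift specOver relFrobeniusOver frobeniusTwistOver frobSpec)
open Literature.NumberTheory.DiophantineGeometry (geomResidueField specialFibreFunctor specResidueField)
open Literature.AlgebraicGeometry.RelativeSpec (ActionOver)
open Literature.NumberTheory.EllipticCurves (genericFibre specGenericPoint)
open Literature.AlgebraicGeometry.GroupSchemes Literature.AlgebraicGeometry.GroupSchemes.GroupSchemeKernel
open Literature.AlgebraicGeometry.GroupSchemes.AffineGroupScheme (Alg quotIncl)
open Literature.AlgebraicGeometry.AbelianSchemes Literature.AlgebraicGeometry.AbelianSchemes.AbelianSchemeOver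
open Summit.HodgeConjecture.HodgeConjecture.Cruxes.HLiu418.F0P6aModuliDatumDefs
open Summit.HodgeConjecture.HodgeConjecture.Cruxes.HLiu418.F0P6aRGDAssembly
open Summit.HodgeConjecture.HodgeConjecture.Cruxes.HLiu418.F0P6aDatumOfInputs
open Summit.HodgeConjecture.HodgeConjecture.Cruxes.HLiu418.F0P6aLineSpecialisation (spGeoOf)
open Summit.HodgeConjecture.HodgeConjecture.Cruxes.HLiu418.F0P6aRoofCwKernel (hlaw_cw_of_dockClauses hsat_sch₀Of)
open Summit.HodgeConjecture.HodgeConjecture.Cruxes.HLiu418.F0P6aRoofFrobKernelLawAssembly (natCast_mem_mul_asIdeal_mul_smul_asIdeal)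

variable {F : Type} [Field F] [NumberField F] [IsCMField F] [IsGalois ℚ F] {ι₁ : F →+* ℂ}
    {Jstar : Matrix (Fin 2) (Fin 2) F}
    {K₀ : C5.OpenCompactSubgroup ↥(finAdelic ↥(maximalRealSubfield F) F (IsCMField.complexConj F) 2 Jstar)}
    {S : RecordSystemGS F Jstar ι₁ K₀} {hU7ₛ : S.HeckeTranslateDefinedOver}
    {hJ : (Jstar.map (IsCMField.complexConj F))ᵀ = Jstar} {hJu : IsUnit Jstar}
    {Fi : Type} [Field Fi] [Algebra F Fi] {Kc : C5.SmallLevel K₀} {G : Type} [Group G]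
    {𝓜 : IntegralModel (𝓞 F) F ((thickening F Fi).obj (S.M.obj Kc))}
    {w : HeightOneSpectrum (𝓞 F)} {hw : (IsCMField.complexConj F) • w ≠ w} {h𝓨 : (𝓜.localise w).IsSmoothProper 1}
    {θ : ActionOver (𝓜.localise w).total.hom ((Fi ≃ₐ[F] Fi) × G)}
    {e : Fi →ₐ[F] AlgebraicClosure (w.adicCompletion F)}

/-! ## §A — from W1 LEGS cand v3 §5 (LA3-p01 (g2)): the `lvlPt₀Of` dictionary lemma (COPY) + `roof₀_of_rows'` (= `roof₀_of_rows` with the three `IsMonHom` explicit) -/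

/-! ### §5 Dictionary (`rfl`-lemmas) between the D-line carriers and the iterated-base-change currency, and the `Roof₀` packaging -/

section Dictionary

variable {X : SchemeOver F} (𝓜₀ : IntegralModel (𝓞 F) F X) (w₀ : HeightOneSpectrum (𝓞 F))
  (𝒜 : AbelianSchemeOver (𝓜₀.localise w₀).total.left) (ρ : AbelianSchemeOver.RingAction (𝓞 F) 𝒜)
  (xbar : AlgPoints (𝓜₀.localise w₀).reductionAt (geomResidueField w₀))

-- (K6 ★ twin — gate `dedup.landed`, LA3-p03 (g7) for dealer LA3-plan (g5)): the tree's LOCAL COPY of `lvlPt₀Of_eq` (8 l. incl. docstring)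
-- is DELETED here; the landed ★ `Summit.HodgeConjecture.HodgeConjecture.Cruxes.HLiu418.F0P6aStubFROBRoofMiddleDual.lvlPt₀Of_eq`
-- (`Theorems/F0P6aStubFROBRoofMiddleDualTop.lean`, the COPY's source) is cited by FQN at its one use site (§ `roof₀_of_junction`).  Every other byte = k6k v1kp 9ebf112c.

end Dictionary

section Packaging

variable {X : SchemeOver F} (𝓜₀ : IntegralModel (𝓞 F) F X) (w₀ : HeightOneSpectrum (𝓞 F))
  (𝒜 : AbelianSchemeOver (𝓜₀.localise w₀).total.left) (ρ : AbelianSchemeOver.RingAction (𝓞 F) 𝒜)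
  (D : 𝒜.DualPair) (pol : 𝒜.Polarization D) {g₀ n : ℕ} (lvl : 𝒜.LevelStructure g₀ n)
  (pChar fDeg : ℕ) [ExpChar (geomResidueField w₀) pChar] (𝔭 𝔠 : Ideal (𝓞 F))
  (xbar xbar'' : AlgPoints (𝓜₀.localise w₀).reductionAt (geomResidueField w₀))

omit [IsCMField F] [IsGalois ℚ F] in
set_option maxHeartbeats 400000 in
/-- `roof₀_of_rows` with the three `IsMonHom` facts as EXPLICIT arguments (W5 junction form: the legs arrive as anonymous-constructor components, and
instance search on the cover leg's iterated base change is form-sensitive — LA3-p02 (g3) note (ii)). [cite: Liu2021, Prop. D.8 (3) p. 135, pp. 136–138] -/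
theorem roof₀_of_rows' (B : AbelianSchemeOver (Spec (CommRingCat.of (geomResidueField w₀)))) (DB : B.DualPair) (lamB : B.X ⟶ DB.hat.X) (hlamB : IsMonHom lamB)
    (hDB : Nonempty ((Scheme.Modules.pullback DB.unitHatSlice).obj DB.P ≅ SheafOfModules.unit _))
    (q : (sch₀Of 𝓜₀ w₀ 𝒜 xbar).X ⟶ B.X) (hqm : IsMonHom q) (c : (sch₀Of 𝓜₀ w₀ 𝒜 xbar'').X ⟶ B.X) (hcm : IsMonHom c)
    (h1 : Flat q.left ∧ Function.Surjective q.left.base)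
    (h2 : ∀ ⦃T : SchemeOver (geomResidueField w₀)⦄ (t : T ⟶ (sch₀Of 𝓜₀ w₀ 𝒜 xbar'').X),
      t ≫ c = 1 ↔ ∀ a ∈ 𝔭, t ≫ (act₀Of 𝓜₀ w₀ 𝒜 ρ a xbar'').hom.hom.hom = 1)
    (h2s : Function.Surjective c.left.base)
    (h3q : haveI := hlamB; haveI := hqm
      q ≫ lamB ≫ DualPair.dualIsogenyOver q (dual₀Of 𝓜₀ w₀ 𝒜 D xbar) DB = (pol₀Of 𝓜₀ w₀ 𝒜 pol xbar).lam ≫ (dual₀Of 𝓜₀ w₀ 𝒜 D xbar).hat.mulN pChar)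
    (h3c : haveI := hlamB; haveI := hcm
      c ≫ lamB ≫ DualPair.dualIsogenyOver c (dual₀Of 𝓜₀ w₀ 𝒜 D xbar'') DB =
      (pol₀Of 𝓜₀ w₀ 𝒜 pol xbar'').lam ≫ (dual₀Of 𝓜₀ w₀ 𝒜 D xbar'').hat.mulN pChar)
    (h4 : ∀ a : 𝓞 F, ∃ b : B.X ⟶ B.X,
      (act₀Of 𝓜₀ w₀ 𝒜 ρ a xbar).hom.hom.hom ≫ q = q ≫ b ∧ (act₀Of 𝓜₀ w₀ 𝒜 ρ a xbar'').hom.hom.hom ≫ c = c ≫ b)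
    (h5 : ∀ a : Fin g₀ ⊕ Fin g₀ → ZMod n,
      (AlgPoints.map q (lvlPt₀Of 𝓜₀ w₀ 𝒜 lvl xbar a) : B.toAffine.toAbelianVariety.Points (geomResidueField w₀)) =
        AlgPoints.map c (lvlPt₀Of 𝓜₀ w₀ 𝒜 lvl xbar'' a))
    (hL : ∀ ⦃T : SchemeOver (geomResidueField w₀)⦄ (t : T ⟶ (sch₀Of 𝓜₀ w₀ 𝒜 xbar).X),
      t ≫ relFrobeniusOver pChar fDeg (sch₀Of 𝓜₀ w₀ 𝒜 xbar).X =
          (1 : T ⟶ ((sch₀Of 𝓜₀ w₀ 𝒜 xbar).baseChange (frobSpec (geomResidueField w₀) pChar fDeg)).X) ↔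
        ∀ a ∈ 𝔠, t ≫ (act₀Of 𝓜₀ w₀ 𝒜 ρ a xbar).hom.hom.hom ≫ q = 1) :
    Roof₀ 𝓜₀ w₀ 𝒜 ρ D pol lvl pChar fDeg 𝔭 𝔠 xbar xbar'' :=
  ⟨B, DB, lamB, hlamB, hDB, q, hqm, c, hcm, h1.1, h1.2, h2, h2s, h3q, h3c, h4, h5, hL⟩

end Packaging


/-! ## §E — THE HOLES AS NAMED `Prop`s (one per supplier; each elaborated ONCE — D-LINE doctrine «each law its own `Prop`») -/

section Holes

variable (I : RGDInputsAt F ι₁ Jstar K₀ S hU7ₛ hJ hJu Fi Kc G 𝓜 w hw h𝓨 θ e) [ExpChar (geomResidueField w) I.pChar]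
  (𝔡 : ∀ xbar, DockAt I xbar)
  (quotΩ : ∀ y, LineOf I y → AlgPoints (S.M.obj Kc) (AlgebraicClosure (w.adicCompletion F)))
  {m : ℕ} (E' : Matrix (Fin m) (Fin m) (𝓞 F)) (hE' : E' * E' = E') (P : Matrix (Fin m) (Fin 1) (𝓞 F))

/-- The TYPE of the reduced leg `q̄_{y,L} : A_{red₀ y} → 𝒞_{red₀ (quotΩ y L)}` (`𝒞 = 𝒜 ⊗ 𝔭_w⁻¹ = serreTensor I.act E' hE'`). [cite: Liu2021, Prop. D.8 (3) p. 135] -/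
abbrev QbarTy : Type :=
  haveI := I.comm
  ∀ (y : AlgPoints (S.M.obj Kc) (AlgebraicClosure (w.adicCompletion F))) (L : LineOf I y),
    (sch₀Of 𝓜 w I.univ (red₀Of S Kc 𝓜 w h𝓨 e y)).X ⟶ (sch₀Of 𝓜 w (serreTensor I.act E' hE') (red₀Of S Kc 𝓜 w h𝓨 e (quotΩ y L))).X

variable (qbarOf : QbarTy I quotΩ E' hE')

/-- HOLE (B0) ⇐ W1 `roofLegs_of_roofLink` (∃-component): `q̄` is a homomorphism. (print: Liu2021, Prop. D.8 (3) p. 135) -/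
def HoleMono : Prop := haveI := I.comm; ∀ (y : AlgPoints (S.M.obj Kc) (AlgebraicClosure (w.adicCompletion F))) (L : LineOf I y), IsMonHom (qbarOf y L)

/-- HOLE (B1) ⇐ W1 clause 1: (r1₀) `q̄` flat and surjective. (print: Liu2021, Prop. D.8 (3) p. 135) -/
def HoleR1 : Prop := haveI := I.comm; ∀ (y : AlgPoints (S.M.obj Kc) (AlgebraicClosure (w.adicCompletion F))) (L : LineOf I y), Flat (qbarOf y L).left ∧ Function.Surjective (qbarOf y L).left.base

/-- HOLE (B4) ⇐ W1 clause 2: (r4₀-q) `ι(a) ≫ q̄ = q̄ ≫ ι_𝒞(a)`. (print: Kottwitz1992, §5 (p. 390)) -/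
def HoleR4q : Prop :=
  haveI := I.comm
  ∀ (y : AlgPoints (S.M.obj Kc) (AlgebraicClosure (w.adicCompletion F))) (L : LineOf I y) (a : 𝓞 F),
    (act₀Of 𝓜 w I.univ I.act a (red₀Of S Kc 𝓜 w h𝓨 e y)).hom.hom.hom ≫ qbarOf y L =
      qbarOf y L ≫ (act₀Of 𝓜 w (serreTensor I.act E' hE') (serreAction I.act E' hE') a (red₀Of S Kc 𝓜 w h𝓨 e (quotΩ y L))).hom.hom.hom

/-- HOLE (B5) ⇐ W1 clause 3: (r5₀-q) level points through `q̄` are the points of the sections `σ^a ≫ ψ_P` of `𝒞`.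
(print: MumfordFogartyKirwan1994, Ch. 7 §2 Definition 7.2 (p. 129)) -/
def HoleR5q : Prop :=
  haveI := I.comm
  ∀ (y : AlgPoints (S.M.obj Kc) (AlgebraicClosure (w.adicCompletion F))) (L : LineOf I y) (a : Fin I.g ⊕ Fin I.g → ZMod I.N),
    AlgPoints.map (qbarOf y L) ((I.univ.baseChange (pullback.fst (𝓜.localise w).total.hom (specResidueField w))).restrictPt (red₀Of S Kc 𝓜 w h𝓨 e y).left (I.univ.sectionBaseChange (pullback.fst (𝓜.localise w).total.hom (specResidueField w)) (I.lvl.section_ a))) =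
      ((serreTensor I.act E' hE').baseChange (pullback.fst (𝓜.localise w).total.hom (specResidueField w))).restrictPt (red₀Of S Kc 𝓜 w h𝓨 e (quotΩ y L)).left
        ((serreTensor I.act E' hE').sectionBaseChange (pullback.fst (𝓜.localise w).total.hom (specResidueField w)) (I.lvl.section_ a ≫ serreTranslate I.act E' hE' P))

/-- HOLE (B3) ⇐ W1 clause 4: (r3₀-q) for EVERY downstairs `(DB̄, λ_B̄)` with the `c̄`-row (Defs currency `dual₀Of∕pol₀Of`). [cite: MumfordAV1970, §23 Thm. 2 (p. 231)] -/
def HoleR3q (hmono : HoleMono I quotΩ E' hE' qbarOf) : Prop :=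
  haveI := I.comm
  ∀ (y : AlgPoints (S.M.obj Kc) (AlgebraicClosure (w.adicCompletion F))) (L : LineOf I y),
    haveI := hmono y L
    ∀ (DBs : (sch₀Of 𝓜 w (serreTensor I.act E' hE') (red₀Of S Kc 𝓜 w h𝓨 e (quotΩ y L))).DualPair)
    (_ : Nonempty ((Scheme.Modules.pullback (DualPair.unitHatSlice DBs)).obj DBs.P ≅ SheafOfModules.unit _))
    (lamBs : (sch₀Of 𝓜 w (serreTensor I.act E' hE') (red₀Of S Kc 𝓜 w h𝓨 e (quotΩ y L))).X ⟶ DBs.hat.X) [IsMonHom lamBs],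
    (haveI := isMonHom_coverLeg (pullback.fst (𝓜.localise w).total.hom (specResidueField w)) (red₀Of S Kc 𝓜 w h𝓨 e (quotΩ y L)).left I.act E' hE' P
     baseChangeHom (baseChangeHom (serreTranslate I.act E' hE' P) (pullback.fst (𝓜.localise w).total.hom (specResidueField w))) (red₀Of S Kc 𝓜 w h𝓨 e (quotΩ y L)).left ≫ lamBs ≫
        DualPair.dualIsogenyOver (baseChangeHom (baseChangeHom (serreTranslate I.act E' hE' P) (pullback.fst (𝓜.localise w).total.hom (specResidueField w))) (red₀Of S Kc 𝓜 w h𝓨 e (quotΩ y L)).left)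
          (dual₀Of 𝓜 w I.univ I.dual (red₀Of S Kc 𝓜 w h𝓨 e (quotΩ y L))) DBs =
      (pol₀Of 𝓜 w I.univ I.pol (red₀Of S Kc 𝓜 w h𝓨 e (quotΩ y L))).lam ≫ (dual₀Of 𝓜 w I.univ I.dual (red₀Of S Kc 𝓜 w h𝓨 e (quotΩ y L))).hat.mulN I.pChar) →
    qbarOf y L ≫ lamBs ≫ DualPair.dualIsogenyOver (qbarOf y L) (dual₀Of 𝓜 w I.univ I.dual (red₀Of S Kc 𝓜 w h𝓨 e y)) DBs =
      (pol₀Of 𝓜 w I.univ I.pol (red₀Of S Kc 𝓜 w h𝓨 e y)).lam ≫ (dual₀Of 𝓜 w I.univ I.dual (red₀Of S Kc 𝓜 w h𝓨 e y)).hat.mulN I.pChar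

/-- HOLE (E) ⇐ W1 §2 `exists_roofMiddleDual₀`: the downstairs dual `(DB̄, λ_B̄)` of `𝒞_x̄` with unit pin and `c̄ ≫ λ_B̄ ≫ c̄^∨ = λ_x̄ ≫ [p]`.
(print: MumfordAV1970, §23 Thm. 2 (p. 231), §15 Thm. 1 (p. 143)) -/
def HoleMiddle : Prop :=
  haveI := I.comm
  ∀ (xbar : AlgPoints (𝓜.localise w).reductionAt (geomResidueField w)),
    ∃ (DBs : (sch₀Of 𝓜 w (serreTensor I.act E' hE') xbar).DualPair)
      (_ : Nonempty ((Scheme.Modules.pullback (DualPair.unitHatSlice DBs)).obj DBs.P ≅ SheafOfModules.unit _))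
      (lamBs : (sch₀Of 𝓜 w (serreTensor I.act E' hE') xbar).X ⟶ DBs.hat.X) (_ : IsMonHom lamBs),
      haveI := isMonHom_coverLeg (pullback.fst (𝓜.localise w).total.hom (specResidueField w)) xbar.left I.act E' hE' P
      baseChangeHom (baseChangeHom (serreTranslate I.act E' hE' P) (pullback.fst (𝓜.localise w).total.hom (specResidueField w))) xbar.left ≫ lamBs ≫
          DualPair.dualIsogenyOver (baseChangeHom (baseChangeHom (serreTranslate I.act E' hE' P) (pullback.fst (𝓜.localise w).total.hom (specResidueField w))) xbar.left)
            (dual₀Of 𝓜 w I.univ I.dual xbar) DBs =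
        (pol₀Of 𝓜 w I.univ I.pol xbar).lam ≫ (dual₀Of 𝓜 w I.univ I.dual xbar).hat.mulN I.pChar

/-- HOLE (C) ⇐ (hker-DOWN) (LA1-p04 (K2)(K3) glue): `Ker q̄ ⊆ A_x̄[𝔭_w·𝔭_{c•w}]`. (print: Liu2021, Prop. D.8 (3) pp. 136–137) -/
def HoleKer : Prop :=
  haveI := I.comm
  ∀ (y : AlgPoints (S.M.obj Kc) (AlgebraicClosure (w.adicCompletion F))) (L : LineOf I y) ⦃T : SchemeOver (geomResidueField w)⦄ (z : T ⟶ (sch₀Of 𝓜 w I.univ (red₀Of S Kc 𝓜 w h𝓨 e y)).X),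
    z ≫ qbarOf y L = 1 →
    ∀ b ∈ w.asIdeal * ((IsCMField.complexConj F) • w).asIdeal, z ≫ (act₀Of 𝓜 w I.univ I.act b (red₀Of S Kc 𝓜 w h𝓨 e y)).hom.hom.hom = 1

/-- HOLE (D) ⇐ (ρ1𝒞) §B ∘ W7 §3∕§4 ∘ (K4-𝔞) (LA1-p01 ∕ LA3-p03 ∕ LA1-p03; 08:08:22Z route): under the GUARD `spGeoOf = kerFOf`, the dock clause of `q̄` at the
Frobenius-kernel line. (print: Tate1997FiniteFlatGroupSchemes, (3.7)) -/
def HoleDock : Prop :=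
  haveI := I.comm
  ∀ (y : AlgPoints (S.M.obj Kc) (AlgebraicClosure (w.adicCompletion F))) (L : LineOf I y), spGeoOf I 𝔡 y L = kerFOf I 𝔡 (red₀Of S Kc 𝓜 w h𝓨 e y) →
    ∀ ⦃T : SchemeOver (geomResidueField w)⦄ (t : T ⟶ (𝔡 (red₀Of S Kc 𝓜 w h𝓨 e y)).G₀),
      haveI := (𝔡 (red₀Of S Kc 𝓜 w h𝓨 e y)).aff₀
      t ≫ (𝔡 (red₀Of S Kc 𝓜 w h𝓨 e y)).ι₀G ≫ qbarOf y L = 1 ↔ ∃ s, s ≫ quotIncl (𝔡 (red₀Of S Kc 𝓜 w h𝓨 e y)).G₀ (kerFOf I 𝔡 (red₀Of S Kc 𝓜 w h𝓨 e y)).1 = t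

/-- HOLE (F) ⇐ W7 §5 `hF_sch₀Of` (LA3-p03 (g3) ★ p850091∕p850282 + glue): the dock FROBENIUS law. (print: SGA3I, VII_A 4.1) -/
def HoleHF : Prop :=
  ∀ (xbar : AlgPoints (𝓜.localise w).reductionAt (geomResidueField w)) ⦃T : SchemeOver (geomResidueField w)⦄ (t : T ⟶ (𝔡 xbar).G₀),
    t ≫ (𝔡 xbar).ι₀G ≫ relFrobeniusOver I.pChar I.fDeg (sch₀Of 𝓜 w I.univ xbar).X =
        (1 : T ⟶ ((sch₀Of 𝓜 w I.univ xbar).baseChange (frobSpec (geomResidueField w) I.pChar I.fDeg)).X) ↔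
      haveI := (𝔡 xbar).aff₀
      ∃ s, s ≫ quotIncl (𝔡 xbar).G₀ (kerFOf I 𝔡 xbar).1 = t

/-- HOLE (H) ⇐ (W-ε) `hlaw_w_sch₀Of` (A-p03 (g32) f507ee09, W-DOCK `rL_W'` at `x̄`; fed by W1 §2, (B3), (B4), (C), (D), (F), ★ `hsat_sch₀Of`, ★ p850336∕p850351,
W7 `hrkw`∕`hrkN`): the `w`-BLOCK LAW at `x̄ = red₀ y` for the co-ideal `frobIdeal γ` and `q̄`, under GUARD(σ,γ). [cite: Liu2021, Prop. D.8 (3) pp. 136–138] -/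
def HoleHlawW (𝔞 frobIdeal : (Fi ≃ₐ[F] Fi) → Ideal (𝓞 F)) : Prop :=
  haveI := I.comm
  ∀ (σ : Field.absoluteGaloisGroup (w.adicCompletion F)), IsAbsArithFrob σ → ∀ gam : Fi ≃ₐ[F] Fi,
    ((AlgEquiv.restrictScalars F (Field.absoluteGaloisGroup.toAlgEquiv (w.adicCompletion F) σ) :
            AlgebraicClosure (w.adicCompletion F) ≃ₐ[F] AlgebraicClosure (w.adicCompletion F)) :
            AlgebraicClosure (w.adicCompletion F) →ₐ[F] AlgebraicClosure (w.adicCompletion F)).comp e = e.comp (gam : Fi →ₐ[F] Fi) →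
    frobIdeal gam * w.asIdeal = 𝔞 gam →
    ∀ (y : AlgPoints (S.M.obj Kc) (AlgebraicClosure (w.adicCompletion F))) (L : LineOf I y), spGeoOf I 𝔡 y L = kerFOf I 𝔡 (red₀Of S Kc 𝓜 w h𝓨 e y) →
      ∀ (n : ℕ) ⦃T : SchemeOver (geomResidueField w)⦄ (x : T ⟶ (sch₀Of 𝓜 w I.univ (red₀Of S Kc 𝓜 w h𝓨 e y)).X),
      x ≫ (sch₀Of 𝓜 w I.univ (red₀Of S Kc 𝓜 w h𝓨 e y)).mulN (I.pChar ^ I.fDeg) = 1 →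
      (∀ b ∈ w.asIdeal ^ n, x ≫ (act₀Of 𝓜 w I.univ I.act b (red₀Of S Kc 𝓜 w h𝓨 e y)).hom.hom.hom = 1) →
      ((x ≫ relFrobeniusOver I.pChar I.fDeg (sch₀Of 𝓜 w I.univ (red₀Of S Kc 𝓜 w h𝓨 e y)).X =
          (1 : T ⟶ ((sch₀Of 𝓜 w I.univ (red₀Of S Kc 𝓜 w h𝓨 e y)).baseChange (frobSpec (geomResidueField w) I.pChar I.fDeg)).X)) ↔
        ∀ a ∈ frobIdeal gam, x ≫ (act₀Of 𝓜 w I.univ I.act a (red₀Of S Kc 𝓜 w h𝓨 e y)).hom.hom.hom ≫ qbarOf y L = 1)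

/-- HOLE (I) ⇐ W3 ED. 1 `hL_sch₀Of` (LA1-p03 (g3) cand v6 cf7bc338, binders TOKEN FOR TOKEN): the (rL) assembly at `x̄` over abstract `𝔞γ hban h𝔠 hq`.
(print: Liu2021, Prop. D.8 (3) p. 135, pp. 136–138) (print: Shimura1998, §13.1 Thm. 1 (pp. 97–99)) -/
def HoleRL : Prop :=
  ∀ [PerfectField (geomResidueField w)] [Fact I.pChar.Prime] [CharP (geomResidueField w) I.pChar]
    (𝔞γ : Ideal (𝓞 F)) (_hban : FrobKernelBanal₀ S Kc 𝓜 w h𝓨 e I.univ I.act I.pChar I.fDeg 𝔞γ)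
    (y : AlgPoints (S.M.obj Kc) (AlgebraicClosure (w.adicCompletion F)))
    (act : AbelianSchemeOver.RingAction (𝓞 F) (sch₀Of 𝓜 w I.univ (red₀Of S Kc 𝓜 w h𝓨 e y)))
    (_hact : ∀ a : 𝓞 F, act.i a = (act₀Of 𝓜 w I.univ I.act a (red₀Of S Kc 𝓜 w h𝓨 e y)).hom.hom.hom)
    {Y : SchemeOver (geomResidueField w)} [GrpObj Y] (qbar : (sch₀Of 𝓜 w I.univ (red₀Of S Kc 𝓜 w h𝓨 e y)).X ⟶ Y) [IsMonHom qbar]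
    {𝔠 : Ideal (𝓞 F)} (_h𝔠 : 𝔠 * w.asIdeal = 𝔞γ)
    (_hq : ((I.pChar ^ I.fDeg : ℕ) : 𝓞 F) ∈ 𝔠 * (w.asIdeal * ((IsCMField.complexConj F) • w).asIdeal))
    [DecidableEq (Ideal (𝓞 F))] (ε : Ideal (𝓞 F) → 𝓞 F)
    (_hε1 : ∀ P ∈ (UniqueFactorizationMonoid.normalizedFactors (Ideal.span {((I.pChar ^ I.fDeg : ℕ) : 𝓞 F)})).toFinset,
      ε P - 1 ∈ P ^ (UniqueFactorizationMonoid.normalizedFactors (Ideal.span {((I.pChar ^ I.fDeg : ℕ) : 𝓞 F)})).count P)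
    (_hε0 : ∀ P ∈ (UniqueFactorizationMonoid.normalizedFactors (Ideal.span {((I.pChar ^ I.fDeg : ℕ) : 𝓞 F)})).toFinset,
      ∀ P' ∈ (UniqueFactorizationMonoid.normalizedFactors (Ideal.span {((I.pChar ^ I.fDeg : ℕ) : 𝓞 F)})).toFinset, P' ≠ P →
        ε P ∈ P' ^ (UniqueFactorizationMonoid.normalizedFactors (Ideal.span {((I.pChar ^ I.fDeg : ℕ) : 𝓞 F)})).count P')
    (_hker : ∀ ⦃T : SchemeOver (geomResidueField w)⦄ (z : T ⟶ (sch₀Of 𝓜 w I.univ (red₀Of S Kc 𝓜 w h𝓨 e y)).X), z ≫ qbar = 1 →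
      ∀ b ∈ w.asIdeal * ((IsCMField.complexConj F) • w).asIdeal, z ≫ (act₀Of 𝓜 w I.univ I.act b (red₀Of S Kc 𝓜 w h𝓨 e y)).hom.hom.hom = 1)
    (_hlaw : ∀ v : HeightOneSpectrum (𝓞 F), v = w ∨ v = (IsCMField.complexConj F) • w →
      ∀ (n : ℕ) ⦃T : SchemeOver (geomResidueField w)⦄ (x : T ⟶ (sch₀Of 𝓜 w I.univ (red₀Of S Kc 𝓜 w h𝓨 e y)).X),
      x ≫ (sch₀Of 𝓜 w I.univ (red₀Of S Kc 𝓜 w h𝓨 e y)).mulN (I.pChar ^ I.fDeg) = 1 →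
      (∀ b ∈ v.asIdeal ^ n, x ≫ (act₀Of 𝓜 w I.univ I.act b (red₀Of S Kc 𝓜 w h𝓨 e y)).hom.hom.hom = 1) →
      ((x ≫ relFrobeniusOver I.pChar I.fDeg (sch₀Of 𝓜 w I.univ (red₀Of S Kc 𝓜 w h𝓨 e y)).X =
          (1 : T ⟶ ((sch₀Of 𝓜 w I.univ (red₀Of S Kc 𝓜 w h𝓨 e y)).baseChange (frobSpec (geomResidueField w) I.pChar I.fDeg)).X)) ↔
        ∀ a ∈ 𝔠, x ≫ (act₀Of 𝓜 w I.univ I.act a (red₀Of S Kc 𝓜 w h𝓨 e y)).hom.hom.hom ≫ qbar = 1))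
    ⦃T : SchemeOver (geomResidueField w)⦄ (t : T ⟶ (sch₀Of 𝓜 w I.univ (red₀Of S Kc 𝓜 w h𝓨 e y)).X),
    (t ≫ relFrobeniusOver I.pChar I.fDeg (sch₀Of 𝓜 w I.univ (red₀Of S Kc 𝓜 w h𝓨 e y)).X =
        (1 : T ⟶ ((sch₀Of 𝓜 w I.univ (red₀Of S Kc 𝓜 w h𝓨 e y)).baseChange (frobSpec (geomResidueField w) I.pChar I.fDeg)).X)) ↔
      ∀ a ∈ 𝔠, t ≫ act.i a ≫ qbar = 1

end Holes

/-! ## §F — THE ★ COVER-LEG ROWS AT `x̄″` IN `Roof₀` CURRENCY (own budget): (r2₀), surjectivity, (r4₀-c), (r5₀-c) -/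

section CoverLeg

variable (I : RGDInputsAt F ι₁ Jstar K₀ S hU7ₛ hJ hJu Fi Kc G 𝓜 w hw h𝓨 θ e)
  {m : ℕ} (E' : Matrix (Fin m) (Fin m) (𝓞 F)) (hE' : E' * E' = E') (P : Matrix (Fin m) (Fin 1) (𝓞 F)) (Q : Matrix (Fin 1) (Fin m) (𝓞 F))

set_option maxHeartbeats 400000 in
/-- **The cover leg `c̄ = (ψ_P ×_𝓨 𝓨_s)_x̄″ : A_x̄″ → 𝒞_x̄″` and its four `Roof₀` rows** (★ p847713 `isMonHom_coverLeg`, `comp_coverLeg_eq_one_iff_forall_mem` (r2₀),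
`surjective_coverLeg_left`, `i_comp_coverLeg` (r4₀-c); ★ `map_coverLeg_restrictPt_sectionBaseChange` + `lvlPt₀Of_eq` (r5₀-c)) packaged ONCE in `sch₀Of`∕`act₀Of`∕`lvlPt₀Of`
currency (the Defs seams are `rfl`). [cite: Conrad2004GrossZagier, §7 (Thm. 7.5)] [cite: RapoportSmithlingZhang2020Diagonal, §4.3 (4.23) (p. 21)] -/
theorem coverLeg_rows (hP : E' * P = P) (hQ : Q * E' = Q) (hQP : Q * P = Matrix.scalar (Fin 1) (I.pChar : 𝓞 F))
    (hPQ : P * Q = Matrix.scalar (Fin m) (I.pChar : 𝓞 F) * E') (h𝔭 : Ideal.span (Set.range fun k => P k 0) = w.asIdeal)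
    (xbar'' : AlgPoints (𝓜.localise w).reductionAt (geomResidueField w)) :
    haveI := I.comm
    ∃ (c : (sch₀Of 𝓜 w I.univ xbar'').X ⟶ (sch₀Of 𝓜 w (serreTensor I.act E' hE') xbar'').X) (_ : IsMonHom c),
      c = baseChangeHom (baseChangeHom (serreTranslate I.act E' hE' P) (pullback.fst (𝓜.localise w).total.hom (specResidueField w))) xbar''.left ∧
      (∀ ⦃T : SchemeOver (geomResidueField w)⦄ (t : T ⟶ (sch₀Of 𝓜 w I.univ xbar'').X),
        t ≫ c = 1 ↔ ∀ a ∈ w.asIdeal, t ≫ (act₀Of 𝓜 w I.univ I.act a xbar'').hom.hom.hom = 1) ∧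
      Function.Surjective c.left.base ∧
      (∀ a : 𝓞 F, (act₀Of 𝓜 w I.univ I.act a xbar'').hom.hom.hom ≫ c =
        c ≫ (act₀Of 𝓜 w (serreTensor I.act E' hE') (serreAction I.act E' hE') a xbar'').hom.hom.hom) ∧
      (∀ a : Fin I.g ⊕ Fin I.g → ZMod I.N,
        AlgPoints.map c (lvlPt₀Of 𝓜 w I.univ I.lvl xbar'' a) =
          ((serreTensor I.act E' hE').baseChange (pullback.fst (𝓜.localise w).total.hom (specResidueField w))).restrictPt xbar''.left
            ((serreTensor I.act E' hE').sectionBaseChange (pullback.fst (𝓜.localise w).total.hom (specResidueField w)) (I.lvl.section_ a ≫ serreTranslate I.act E' hE' P))) := by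
  haveI := I.comm
  refine ⟨baseChangeHom (baseChangeHom (serreTranslate I.act E' hE' P) (pullback.fst (𝓜.localise w).total.hom (specResidueField w))) xbar''.left,
    isMonHom_coverLeg (pullback.fst (𝓜.localise w).total.hom (specResidueField w)) xbar''.left I.act E' hE' P, rfl, fun T t => ?_, ?_, fun a => ?_, fun a => ?_⟩
  · exact comp_coverLeg_eq_one_iff_forall_mem (pullback.fst (𝓜.localise w).total.hom (specResidueField w)) xbar''.left I.act E' hE' P hP h𝔭 t
  · exact (surjective_coverLeg_left (pullback.fst (𝓜.localise w).total.hom (specResidueField w)) xbar''.left I.act E' hE' P Q I.hpChar.1.ne_zero hP hQ hQP hPQ).1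
  · exact i_comp_coverLeg (pullback.fst (𝓜.localise w).total.hom (specResidueField w)) xbar''.left I.act E' hE' P hP a
  · exact (congrArg (AlgPoints.map _) (Summit.HodgeConjecture.HodgeConjecture.Cruxes.HLiu418.F0P6aStubFROBRoofMiddleDual.lvlPt₀Of_eq 𝓜 w I.univ xbar'' I.lvl a)).trans
      (map_coverLeg_restrictPt_sectionBaseChange (pullback.fst (𝓜.localise w).total.hom (specResidueField w)) xbar''.left I.act E' hE' P (I.lvl.section_ a))

end CoverLeg

/-! ## §F′ — THE PACKAGING AT A PAIR OF SPECIAL POINTS, all rows in their native currencies (own budget; the (r4₀)(r5₀)(rL) joins) -/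

section Pack

variable (I : RGDInputsAt F ι₁ Jstar K₀ S hU7ₛ hJ hJu Fi Kc G 𝓜 w hw h𝓨 θ e) [ExpChar (geomResidueField w) I.pChar]
  {m : ℕ} (E' : Matrix (Fin m) (Fin m) (𝓞 F)) (hE' : E' * E' = E') (P : Matrix (Fin m) (Fin 1) (𝓞 F))

set_option maxHeartbeats 400000 in
/-- **`Roof₀` at `(x̄, x̄″)` with middle `𝒞_x̄″` from: the leg `q̄` (rows (r1₀)(r3₀-q)(r4₀-q)(r5₀-q)), the cover leg `c̄` (rows (r2₀), surjective, (r3₀-c)(r4₀-c)(r5₀-c) — the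
two (r4₀) halves sharing `b := ι_𝒞(a)` and the two (r5₀) halves sharing the point of `σ^a ≫ ψ_P`), and the (rL) law in the RAW action currency `act.i a` with its `rfl`-seam
`hact` (W3's output shape) — joined by REWRITING along `hact` (no `act₀Of` unfolding).  = §A `roof₀_of_rows'` + the three joins. [cite: Liu2021, Prop. D.8 (3) p. 135, pp. 136–138] -/
theorem roof₀_of_junction (𝔭 𝔠 : Ideal (𝓞 F)) (xbar xbar'' : AlgPoints (𝓜.localise w).reductionAt (geomResidueField w))
    (q : haveI := I.comm; (sch₀Of 𝓜 w I.univ xbar).X ⟶ (sch₀Of 𝓜 w (serreTensor I.act E' hE') xbar'').X) (hqm : haveI := I.comm; IsMonHom q)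
    (DB : haveI := I.comm; (sch₀Of 𝓜 w (serreTensor I.act E' hE') xbar'').DualPair)
    (hDB : haveI := I.comm; Nonempty ((Scheme.Modules.pullback (DualPair.unitHatSlice DB)).obj DB.P ≅ SheafOfModules.unit _))
    (lamB : haveI := I.comm; (sch₀Of 𝓜 w (serreTensor I.act E' hE') xbar'').X ⟶ DB.hat.X) (hlamB : haveI := I.comm; IsMonHom lamB)
    (c : haveI := I.comm; (sch₀Of 𝓜 w I.univ xbar'').X ⟶ (sch₀Of 𝓜 w (serreTensor I.act E' hE') xbar'').X) (hcm : haveI := I.comm; IsMonHom c)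
    (h1 : Flat q.left ∧ Function.Surjective q.left.base)
    (h2 : ∀ ⦃T : SchemeOver (geomResidueField w)⦄ (t : T ⟶ (sch₀Of 𝓜 w I.univ xbar'').X),
      t ≫ c = 1 ↔ ∀ a ∈ 𝔭, t ≫ (act₀Of 𝓜 w I.univ I.act a xbar'').hom.hom.hom = 1)
    (h2s : Function.Surjective c.left.base)
    (h3q : haveI := I.comm; haveI := hlamB; haveI := hqm
      q ≫ lamB ≫ DualPair.dualIsogenyOver q (dual₀Of 𝓜 w I.univ I.dual xbar) DB = (pol₀Of 𝓜 w I.univ I.pol xbar).lam ≫ (dual₀Of 𝓜 w I.univ I.dual xbar).hat.mulN I.pChar)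
    (h3c : haveI := I.comm; haveI := hlamB; haveI := hcm
      c ≫ lamB ≫ DualPair.dualIsogenyOver c (dual₀Of 𝓜 w I.univ I.dual xbar'') DB =
      (pol₀Of 𝓜 w I.univ I.pol xbar'').lam ≫ (dual₀Of 𝓜 w I.univ I.dual xbar'').hat.mulN I.pChar)
    (h4q : haveI := I.comm; ∀ a : 𝓞 F, (act₀Of 𝓜 w I.univ I.act a xbar).hom.hom.hom ≫ q =
      q ≫ (act₀Of 𝓜 w (serreTensor I.act E' hE') (serreAction I.act E' hE') a xbar'').hom.hom.hom)
    (h4c : haveI := I.comm; ∀ a : 𝓞 F, (act₀Of 𝓜 w I.univ I.act a xbar'').hom.hom.hom ≫ c =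
      c ≫ (act₀Of 𝓜 w (serreTensor I.act E' hE') (serreAction I.act E' hE') a xbar'').hom.hom.hom)
    (h5q : haveI := I.comm; ∀ a : Fin I.g ⊕ Fin I.g → ZMod I.N,
      AlgPoints.map q (lvlPt₀Of 𝓜 w I.univ I.lvl xbar a) =
        ((serreTensor I.act E' hE').baseChange (pullback.fst (𝓜.localise w).total.hom (specResidueField w))).restrictPt xbar''.left
          ((serreTensor I.act E' hE').sectionBaseChange (pullback.fst (𝓜.localise w).total.hom (specResidueField w)) (I.lvl.section_ a ≫ serreTranslate I.act E' hE' P)))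
    (h5c : haveI := I.comm; ∀ a : Fin I.g ⊕ Fin I.g → ZMod I.N,
      AlgPoints.map c (lvlPt₀Of 𝓜 w I.univ I.lvl xbar'' a) =
        ((serreTensor I.act E' hE').baseChange (pullback.fst (𝓜.localise w).total.hom (specResidueField w))).restrictPt xbar''.left
          ((serreTensor I.act E' hE').sectionBaseChange (pullback.fst (𝓜.localise w).total.hom (specResidueField w)) (I.lvl.section_ a ≫ serreTranslate I.act E' hE' P)))
    (act : AbelianSchemeOver.RingAction (𝓞 F) (sch₀Of 𝓜 w I.univ xbar))
    (hact : ∀ a : 𝓞 F, act.i a = (act₀Of 𝓜 w I.univ I.act a xbar).hom.hom.hom)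
    (hL : haveI := I.comm; ∀ ⦃T : SchemeOver (geomResidueField w)⦄ (t : T ⟶ (sch₀Of 𝓜 w I.univ xbar).X),
      (t ≫ relFrobeniusOver I.pChar I.fDeg (sch₀Of 𝓜 w I.univ xbar).X =
          (1 : T ⟶ ((sch₀Of 𝓜 w I.univ xbar).baseChange (frobSpec (geomResidueField w) I.pChar I.fDeg)).X)) ↔
        ∀ a ∈ 𝔠, t ≫ act.i a ≫ q = 1) :
    Roof₀ 𝓜 w I.univ I.act I.dual I.pol I.lvl I.pChar I.fDeg 𝔭 𝔠 xbar xbar'' := by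
  haveI := I.comm
  refine roof₀_of_rows' 𝓜 w I.univ I.act I.dual I.pol I.lvl I.pChar I.fDeg 𝔭 𝔠 xbar xbar''
    (sch₀Of 𝓜 w (serreTensor I.act E' hE') xbar'') DB lamB hlamB hDB q hqm c hcm h1 h2 h2s h3q h3c
    (fun a => ⟨_, h4q a, h4c a⟩) (fun a => (h5q a).trans (h5c a).symm) (fun T t => ?_)
  rw [hL t]
  refine forall₂_congr fun a _ => ?_
  rw [hact a]
  exact Iff.rfl

end Pack


/-! (★ re-home, size lint: PART 1 of 2 ends here at tree line :361; the workfile continues, in the same namespace, in `Theorems/F0P6aStubFROBRoofGeo.lean`.) -/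

end Summit.HodgeConjecture.HodgeConjecture.Cruxes.HLiu418.F0P6aStubFROBRoofGeo
end
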